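import Summits.QuantumFields.YangMills.Theorems.FluctuationComparisonRegPrIntLS2BetaStratumBodyGaugeWLOG
import HarnessLib

/-!
# S2β · strata residue of GAP♯∘ — THE DATUM-GAUGE WLOG DOOR WITH A CO-HEIGHT FLOOR: ✓`gapStratum_of_goodGauge` with the gauge SUPPLIER asked, and the stratum gap body
# concluded, only at heights `J ≥ J₀` — the shape in which the small-bond bridge `hsupp(G, G ∧ G_{s₀})` is NOT refuted by torons

Cell `ym3-torus` (YM ladder rung R3 = continuum `SU(2)` Yang–Mills on the three-torus at fixed lattice data — a RUNG: NOT d = 4, NOT infinite volume, NOT a mass gap,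
NOT Clay).  Width seat «width 5» `ym3-torus-px5` (gen 24), FREE px helper on crux `stmt-QuantumFields-20520`; `--kind proof --supports stmt-QuantumFields-20520 --as
helper`, count-neutral, DEFINITION-FREE (0 `def`, 0 `instance`, 0 `notation`, 0 `sorry`; default heartbeats).

WHY (LEAD w3 g29 №26 ∕ RULING №65; architect-lineage px17 g23 (R1)–(R3) «GUARDED STRATA + ONE NAMED BRIDGE», adopted 23:17:52Z).  The sup chain's letters are now produced
at the GAUGE-FIXED strata `G ∧ G_{s₀}` (`G_{s₀} F J V := ∀ e, ‖logVec (su2Quat (V e))‖ ≤ s₀`), and the ONE bridge back to GAP♯∘'s gauge-invariant strata `G ∈ {G_IRR, G_A′}`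
is px12 g24's ✓`…StratumBodyGaugeWLOG.gapStratum_of_goodGauge (G G′) (hsupp) (hbody′)` with the supplier `hsupp(G, G′) : ∀ … ∀ J V, PlaqSmall → G V → ∃ u, G′(u•V)`.
As a `J`-UNIFORM letter that supplier is FALSE BY KERNEL at `G := G_A′`, `G′ := G_A′ ∧ G_{s₀}` for every `s₀ ≤ 1∕4` (px8 g24 ✓`…SmallBondGaugeToronAbelianStratum.not_hsupp_abelianStratum_five`:
the flat `e₀`-toron on the `(L, m, J) = (5, 1, 0)` torus lies on `A′` and no gauge brings its bonds below `π∕12`; LEAD №21 ∕ desk RULING №115 «D-GUARD-Q»: the small-bond guard is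
reachable by gauge only for `N_J = 2L^{F.m+J} ≥ π∕s₀`).  RULING №65 put the cure on the LINE's side — the S2β letter is asked only at heights `J ≥ J₀` (ideator g33 v19.2
«SEED HEIGHT FLOOR») — so the bridge must be read WITH THE SAME FLOOR.  THIS FILE is that door: the ✓ proof is pointwise in `J`, so the floor threads through unchanged.

WHAT IS PROVED (sorry-free).  ★★★ `gapStratum_of_goodGauge_floor (G G′) (hsupp) (hbody′)` — ✓`gapStratum_of_goodGauge` with EXACTLY these edits: in `hsupp`, `∃ J₀ : ℕ,` inserted
after `γ ≤ γ₁ →` and the binder `(hJ₀ : J₀ ≤ J)` inserted right after `∀ (J : ℕ)`; `hbody′` (the gap body for guard `G′`, all heights) BYTE-IDENTICAL; in the conclusion, `∃ J₀ : ℕ,`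
inserted after `γ ≤ γ₁ →` and `(hJ₀ : J₀ ≤ J)` right after `∀ (J K : ℕ)` (before `(hJK : J ≤ K)` — the binder order of the LINE's v19.2 `… ∀ (J K : ℕ) (hJ₀ : J₀ ≤ J) (hJK : J ≤ K) …`) — the stratum gap body for guard `G` AT HEIGHTS `J ≥ J₀`, same `μ`, the floor being the supplier's.  (`J₀` sits AFTER `∀ F γ` — the
position of the LINE's v19.2 `FluctuationPartSmall` floor (ideator g33 №13, 23:28:25Z: «`… γ ≤ γ₁ → ∃ (J₀ : ℕ) (φ : ℕ → ℝ), … ∀ (J K : ℕ) (hJ₀ : J₀ ≤ J) …`»), so a supplier may let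
it depend on everything quantified before, `F` and `γ` included — the weakest ask; `J₀ := 0` recovers the ✓ door's content.)

DOMAIN SENTENCE (RULING №115 R5).  The door is pure plumbing and holds for every `(G, G′)`; its `hsupp` hypothesis at `G′ := G ∧ G_{s₀}` is INHABITABLE on the toron (lower)
side iff `2L^{1+J₀} ≥ π∕s₀` (№21's table: `J₀ = 4` at `L = 3`, `s₀ = 1∕128`) and remains OPEN on the curvature (upper) side (px17 g23 census 23:10:56Z (3): (BG∞) «volume-uniform
small-bond gauge» — unprinted); under (LOC-G) no `hsupp` is needed at all.  The conclusion is the gap body AT HEIGHTS `J ≥ J₀` — the LINE's v19.2 letter shape — NOT the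
registered `∀ J K` text of `UniformFibreGapOrbit` (registry 3732b7df, untouched).

HONEST SCOPE.  Gauge-covariance plumbing re-run with one more binder; `hsupp` and the `G′`-body are HYPOTHESES; nothing of Bałaban's analysis asserted or proved
([Balaban1985Variational] p.278 «𝔘_k is gauge invariant», Thm 1 p.279); (BG∞)∕(LOC-G)∕the top-`i₀` letter, hD₁∕hD₂, `hDBX`, h3, GAP♯∘ (`stub_uniformFibreGapOrbit`), the five
registered stubs (0∕5), S2β, 20520, 19936, 19200, `YM3TorusSU2` NOT proved; no registered stub closed; rung R3 — NOT d = 4, NOT infinite volume, NOT a mass gap, NOT Clay;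
the Yang–Mills mass gap is NOT proved.
-/

set_option autoImplicit false

noncomputable section

namespace Summit.QuantumFields.YangMills.Theorems.FluctuationComparisonRegPrIntLS2BetaStratumBodyGaugeWLOGFloor

open Finset
open Literature.MathematicalPhysics.QuantumFieldTheory.Balaban1983to89
open T4Continuum T3ContinuumYM3Torus T3UnitScaleTilt T3TiltDescent T3LevelShift BlockAveraging
open T3UnitLawDensityEML (ℰp)
open T3ConstrainedMinimiser (fibre)
open T3PrintedRegularMinimiser (minActionRegPr)
open T3PrintedRegularOrbits (liftTransfTo minActionRegPr_gaugeAct plaqSmall_gaugeAct_iff')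
open Summit.QuantumFields.YangMills.Theorems.FluctuationComparisonRegPrIntLS2BetaResidualGauge (gaugeAct_mem_histGood_iff wilsonAction4_gaugeAct residual_one)
open Summit.QuantumFields.YangMills.Theorems.FluctuationComparisonRegPrIntLS2BetaOrbitDistComparison (sum_dist1_sq_gaugeAct iInf_orbitDistSq_le_of_residual)
open Summit.QuantumFields.YangMills.Theorems.FluctuationComparisonRegPrIntLS2BetaDatumGaugeWLOG
  (gaugeAct_gaugeAct_conj mem_argmin_gaugeAct_liftTransfTo mem_fibre_gaugeAct_liftTransfTo residual_conj_liftTransfTo)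

/-- ★★★ **THE DATUM-GAUGE WLOG FOR THE STRATUM GAP BODY, WITH A CO-HEIGHT FLOOR.**  If every `G`-datum AT HEIGHT `J ≥ J₀` has a gauge representative satisfying `G′`
(supplier `hsupp`, the floor `J₀` chosen by the supplier per `(F, γ)`), and the stratum gap body holds with guard `G′` (all heights), then the stratum gap body holds with guard
`G` at every height `J ≥ J₀` — the same `μ`; the residual-orbit infimum is carried by `w ↦ û⁻¹·w·û` exactly as in ✓`gapStratum_of_goodGauge`.
[cite: Balaban1985Variational, p.278 (sentence after (3)), (4) p.278, Thm 1 p.279] -/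
theorem gapStratum_of_goodGauge_floor (G G' : (F : T3Family) → (J : ℕ) → GaugeField (F.P J) 0 (Matrix.specialUnitaryGroup (Fin 2) ℂ) → Prop)
    (hsupp : ∀ (L : ℕ), ∃ c₀ : ℝ, 0 < c₀ ∧ c₀ ≤ 1 ∧ ∀ (cw : ℝ), 0 < cw → cw ≤ c₀ → ∃ pS : ℝ, ∀ (b₀ p₀ : ℝ), 0 < b₀ → pS ≤ p₀ → 0 < p₀ →
      ∃ γ₁ : ℝ, 0 < γ₁ ∧ ∀ (F : T3Family) (γ : ℝ), F.L = L → 0 < γ → γ ≤ γ₁ → ∃ J₀ : ℕ,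
        ∀ (J : ℕ) (hJ₀ : J₀ ≤ J) (V : GaugeField (F.P J) 0 (Matrix.specialUnitaryGroup (Fin 2) ℂ)), PlaqSmall (θBal F.L γ (cw * b₀) p₀ J) V → G F J V →
          ∃ u : GaugeTransf (F.P J) 0 (Matrix.specialUnitaryGroup (Fin 2) ℂ), G' F J (GaugeField.gaugeAct u V))
    (hbody' : ∀ (L : ℕ), ∃ c₀ : ℝ, 0 < c₀ ∧ c₀ ≤ 1 ∧ ∀ (cw : ℝ), 0 < cw → cw ≤ c₀ → ∃ pS : ℝ, ∀ (b₀ p₀ : ℝ), 0 < b₀ → pS ≤ p₀ → 0 < p₀ → ∃ ε₁ : ℝ, 0 < ε₁ ∧ ∀ (ε₀ : ℝ), 0 < ε₀ → ε₀ ≤ ε₁ →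
    ∃ γ₁ : ℝ, 0 < γ₁ ∧ ∃ μ : ℝ, 0 < μ ∧ ∀ (F : T3Family) (γ : ℝ), F.L = L → 0 < γ → γ ≤ γ₁ →
      ∀ (J K : ℕ) (hJK : J ≤ K) (V : GaugeField (F.P J) 0 (Matrix.specialUnitaryGroup (Fin 2) ℂ)), PlaqSmall (θBal F.L γ (cw * b₀) p₀ J) V →
        G' F J V →
        ∀ U₀ ∈ {U' : GaugeField (F.P K) 0 (Matrix.specialUnitaryGroup (Fin 2) ℂ) | U' ∈ fibre F ℰp J K hJK V ∧ U' ∈ histGood F ℰp (θBal F.L γ b₀ p₀) K J ∧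
            wilsonAction4 U' = minActionRegPr F J K hJK ε₀ V},
        ∀ U ∈ fibre F ℰp J K hJK V, U ∈ histGood F ℰp (θBal F.L γ b₀ p₀) K J →
          μ * ((F.L : ℝ)⁻¹) ^ (2 * (K - J)) *
              (⨅ w : {w : GaugeTransf (F.P K) 0 (Matrix.specialUnitaryGroup (Fin 2) ℂ) | ∀ U : GaugeField (F.P K) 0 (Matrix.specialUnitaryGroup (Fin 2) ℂ),
                  descendTo F ℰp J K hJK (GaugeField.gaugeAct w U) = descendTo F ℰp J K hJK U}, ∑ ℓ : PBond (F.P K) 0,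
                dist1 (U ℓ * ((GaugeField.gaugeAct (w : GaugeTransf (F.P K) 0 (Matrix.specialUnitaryGroup (Fin 2) ℂ)) U₀) ℓ)⁻¹) ^ 2)
            ≤ wilsonAction4 U - minActionRegPr F J K hJK ε₀ V) :
    ∀ (L : ℕ), ∃ c₀ : ℝ, 0 < c₀ ∧ c₀ ≤ 1 ∧ ∀ (cw : ℝ), 0 < cw → cw ≤ c₀ → ∃ pS : ℝ, ∀ (b₀ p₀ : ℝ), 0 < b₀ → pS ≤ p₀ → 0 < p₀ → ∃ ε₁ : ℝ, 0 < ε₁ ∧ ∀ (ε₀ : ℝ), 0 < ε₀ → ε₀ ≤ ε₁ →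
    ∃ γ₁ : ℝ, 0 < γ₁ ∧ ∃ μ : ℝ, 0 < μ ∧ ∀ (F : T3Family) (γ : ℝ), F.L = L → 0 < γ → γ ≤ γ₁ → ∃ J₀ : ℕ,
      ∀ (J K : ℕ) (hJ₀ : J₀ ≤ J) (hJK : J ≤ K) (V : GaugeField (F.P J) 0 (Matrix.specialUnitaryGroup (Fin 2) ℂ)), PlaqSmall (θBal F.L γ (cw * b₀) p₀ J) V →
        G F J V →
        ∀ U₀ ∈ {U' : GaugeField (F.P K) 0 (Matrix.specialUnitaryGroup (Fin 2) ℂ) | U' ∈ fibre F ℰp J K hJK V ∧ U' ∈ histGood F ℰp (θBal F.L γ b₀ p₀) K J ∧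
            wilsonAction4 U' = minActionRegPr F J K hJK ε₀ V},
        ∀ U ∈ fibre F ℰp J K hJK V, U ∈ histGood F ℰp (θBal F.L γ b₀ p₀) K J →
          μ * ((F.L : ℝ)⁻¹) ^ (2 * (K - J)) *
              (⨅ w : {w : GaugeTransf (F.P K) 0 (Matrix.specialUnitaryGroup (Fin 2) ℂ) | ∀ U : GaugeField (F.P K) 0 (Matrix.specialUnitaryGroup (Fin 2) ℂ),
                  descendTo F ℰp J K hJK (GaugeField.gaugeAct w U) = descendTo F ℰp J K hJK U}, ∑ ℓ : PBond (F.P K) 0,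
                dist1 (U ℓ * ((GaugeField.gaugeAct (w : GaugeTransf (F.P K) 0 (Matrix.specialUnitaryGroup (Fin 2) ℂ)) U₀) ℓ)⁻¹) ^ 2)
            ≤ wilsonAction4 U - minActionRegPr F J K hJK ε₀ V := by
  intro L
  obtain ⟨c₁, hc₁, hc₁1, H1⟩ := hbody' L
  obtain ⟨c₂, hc₂, -, H2⟩ := hsupp L
  refine ⟨min c₁ c₂, lt_min hc₁ hc₂, (min_le_left _ _).trans hc₁1, fun cw hcw hcwle => ?_⟩
  obtain ⟨pS₁, H1⟩ := H1 cw hcw (hcwle.trans (min_le_left _ _))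
  obtain ⟨pS₂, H2⟩ := H2 cw hcw (hcwle.trans (min_le_right _ _))
  refine ⟨max pS₁ pS₂, fun b₀ p₀ hb hpS hp => ?_⟩
  obtain ⟨ε₁, hε₁, H1⟩ := H1 b₀ p₀ hb ((le_max_left _ _).trans hpS) hp
  obtain ⟨γS, hγS, H2⟩ := H2 b₀ p₀ hb ((le_max_right _ _).trans hpS) hp
  refine ⟨ε₁, hε₁, fun ε₀ hε₀ hε₀le => ?_⟩
  obtain ⟨γD, hγD, μ, hμ, H1⟩ := H1 ε₀ hε₀ hε₀le
  refine ⟨min γD γS, lt_min hγD hγS, μ, hμ, fun F γ hFL hγ hγle => ?_⟩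
  obtain ⟨J₀, H2⟩ := H2 F γ hFL hγ (hγle.trans (min_le_right _ _))
  refine ⟨J₀, fun J K hJ₀ hJK V hV hG U₀ hU₀ U hU hUg => ?_⟩
  obtain ⟨u, hG'⟩ := H2 J hJ₀ V hV hG
  set û := liftTransfTo F J K hJK u with hû
  have hV' : PlaqSmall (θBal F.L γ (cw * b₀) p₀ J) (GaugeField.gaugeAct u V) := (plaqSmall_gaugeAct_iff' _ u V).mpr hV
  have h := H1 F γ hFL hγ (hγle.trans (min_le_left _ _)) J K hJK (GaugeField.gaugeAct u V) hV' hG'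
    (GaugeField.gaugeAct û U₀) (mem_argmin_gaugeAct_liftTransfTo F hJK hε₀.le u V hU₀)
    (GaugeField.gaugeAct û U) (mem_fibre_gaugeAct_liftTransfTo F hJK u V hU) ((gaugeAct_mem_histGood_iff F û _ J U).mpr hUg)
  rw [wilsonAction4_gaugeAct, minActionRegPr_gaugeAct F hJK hε₀.le] at h
  -- the residual-orbit infimum over `V` is below the one over `u•V`
  haveI : Nonempty {w : GaugeTransf (F.P K) 0 (Matrix.specialUnitaryGroup (Fin 2) ℂ) | ∀ U : GaugeField (F.P K) 0 (Matrix.specialUnitaryGroup (Fin 2) ℂ),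
      descendTo F ℰp J K hJK (GaugeField.gaugeAct w U) = descendTo F ℰp J K hJK U} := ⟨⟨fun _ => 1, residual_one F hJK⟩⟩
  have hinf : (⨅ w : {w : GaugeTransf (F.P K) 0 (Matrix.specialUnitaryGroup (Fin 2) ℂ) | ∀ U : GaugeField (F.P K) 0 (Matrix.specialUnitaryGroup (Fin 2) ℂ),
          descendTo F ℰp J K hJK (GaugeField.gaugeAct w U) = descendTo F ℰp J K hJK U}, ∑ ℓ : PBond (F.P K) 0,
        dist1 (U ℓ * ((GaugeField.gaugeAct (w : GaugeTransf (F.P K) 0 (Matrix.specialUnitaryGroup (Fin 2) ℂ)) U₀) ℓ)⁻¹) ^ 2) ≤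
      ⨅ w : {w : GaugeTransf (F.P K) 0 (Matrix.specialUnitaryGroup (Fin 2) ℂ) | ∀ U : GaugeField (F.P K) 0 (Matrix.specialUnitaryGroup (Fin 2) ℂ),
          descendTo F ℰp J K hJK (GaugeField.gaugeAct w U) = descendTo F ℰp J K hJK U}, ∑ ℓ : PBond (F.P K) 0,
        dist1 ((GaugeField.gaugeAct û U) ℓ * ((GaugeField.gaugeAct (w : GaugeTransf (F.P K) 0 (Matrix.specialUnitaryGroup (Fin 2) ℂ)) (GaugeField.gaugeAct û U₀)) ℓ)⁻¹) ^ 2 := by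
    refine le_ciInf fun w => ?_
    have hw' := residual_conj_liftTransfTo F hJK u w.2
    refine (iInf_orbitDistSq_le_of_residual F hJK U U₀ hw').trans (le_of_eq ?_)
    rw [← sum_dist1_sq_gaugeAct û U, gaugeAct_gaugeAct_conj]
  have hp0 : (0 : ℝ) ≤ μ * ((F.L : ℝ)⁻¹) ^ (2 * (K - J)) := by positivity
  exact (mul_le_mul_of_nonneg_left hinf hp0).trans h

end Summit.QuantumFields.YangMills.Theorems.FluctuationComparisonRegPrIntLS2BetaStratumBodyGaugeWLOGFloor

end
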